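import Summits.ABC.ABC.Theorems.IneffectiveSubspaceDepthCountedABCStubCellOneCases

/-!
# Stub `stub_cellOneOfUniformQuarticThueMahler` of line `Sketch` — crux `IneffectiveSubspace.DepthCountedABC` (stmt-ABC-14938)

THE WEAKEST OPEN FACE OF CELL 1 (lead c19).  On the cell `#{p : v_p(abc) ≥ 5} ≤ 1` abc holds for free at exponent 4
(`c ≤ 2·rad(abc)⁴`, `stub_calibration`).  This certificate pins down the FIRST improvement below 4: it follows from a
UNIFORM BINOMIAL QUARTIC THUE–MAHLER statement (one prime power free) — for some `η > 0`, bounded `Z` for the positive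
coprime solutions of `a + p^k·u = v·Z⁴` with `a·u·v·p ≤ Z^η`, and bounded `Y` for those of `a + u·Y⁴ = p^w·v` with
`a·u·v·p ≤ Y^η` (`p` prime).  Mechanism: order the triple `a ≤ b` and let `p` be the deep prime (if any).  If `p` meets
neither `b` nor `c`, then `bc` is 5-free and `c² ≤ 2bc ≤ 2rad⁴`, i.e. `c < 2rad²`.  If `p ∣ b`, then `a, c` are 5-free,
`c = vZ⁴` with `v ≤ E(c)³` (`E(c)·c = rad(c)⁴`), and `a·u·p⁴·c ≤ rad⁴`, `E(c)·c·p⁴ ≤ rad⁴` (`u = b/p^k`) give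
`a·u·v·p·c⁴ ≤ rad¹⁶`, `c⁴ ≤ rad¹²·Z⁴`; on an exceptional triple `c ≥ rad^(4−δ)` (`δ = min(η,1)/8`) this forces
`a·u·v·p ≤ rad^(4δ) ≤ Z^η`, so `Z` and then `rad` are bounded.  If `p ∣ c`, symmetrically `b = uY⁴`, `a·u·v·p·b⁴ ≤ rad¹⁶`,
`b⁴ ≤ rad¹²·Y⁴` with `c ≤ 2b`, and either `rad^(3η/8) < 32` or `a·u·v·p ≤ Y^η`; again `rad` is bounded.  In print the
hypothesis is open (a fortiori from the Thue case of cell 0, `stub_cellZeroOfUniformQuarticThue`): per coefficient class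
and prime it is Thue–Mahler / Schinzel–Tijdeman finiteness, effective by Baker's method only exponentially in the data.

Sources: skeleton `Cruxes/DepthCountedABC/Lines/Sketch.lean` (lead c19, stub `stub_cellOneOfUniformQuarticThueMahler`); the case
analysis is the companion stub `stub_cellOneCases` (`…StubCellOneCases`); `calibration_one` (`…StubCalibration`).  Mathlib
only otherwise (`Real.rpow_*`, `le_of_pow_le_pow_left₀`).
-/

-- `Summit.<Summit>.<Problem>` is the mandated summit-side namespace (CONVENTIONS §2); for the
-- single-conjunct summit `ABC` the two coincide, so the duplicate `ABC.ABC` is deliberate.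
set_option linter.dupNamespace false

namespace Summit.ABC.ABC.Theorems.DepthCountedABC

/-- Exceptional triples with the deep prime in `b`: from `a·u·v·p·c⁴ ≤ R¹⁶`, `c⁴ ≤ R¹²·Z⁴` and `c ≥ R^(4−η/8)` one gets
`a·u·v·p ≤ R^(η/2) ≤ Z^η`, so the Thue–Mahler hypothesis bounds `Z`, whence `R ≤ B²`. [folklore] -/
theorem cellOne_radius_B {η : ℝ} {B : ℕ} (hη : 0 < η) (hη1 : η ≤ 1)
    (hB : ∀ a u v p k Z : ℕ, p.Prime → 0 < a → 0 < u → 0 < v → 0 < Z →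
        a + p ^ k * u = v * Z ^ 4 → Nat.Coprime (p ^ k * u) (v * Z ^ 4) →
        ((a * u * v * p : ℕ) : ℝ) ≤ (Z : ℝ) ^ η → Z ≤ B)
    {a u v p k Z c R : ℕ} (hp : p.Prime) (ha : 0 < a) (hu : 0 < u) (hv : 0 < v) (hZ : 0 < Z)
    (heq : a + p ^ k * u = v * Z ^ 4) (hcopr : Nat.Coprime (p ^ k * u) (v * Z ^ 4))
    (hN5 : a * u * v * p * c ^ 4 ≤ R ^ 16) (hN6 : c ^ 4 ≤ R ^ 12 * Z ^ 4) (hR1 : 1 ≤ R) (hc : 0 < c)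
    (hexc : (R : ℝ) ^ (4 - η / 8) ≤ (c : ℝ)) : (R : ℝ) ≤ (B : ℝ) ^ 2 := by
  have hx1 : (1 : ℝ) ≤ (R : ℝ) := by exact_mod_cast hR1
  have hx0 : (0 : ℝ) < (R : ℝ) := by linarith
  have hZ1 : (1 : ℝ) ≤ (Z : ℝ) := by exact_mod_cast hZ
  have hZ0 : (0 : ℝ) ≤ (Z : ℝ) := by positivity
  have hcpos : (0 : ℝ) < (c : ℝ) := by exact_mod_cast hc
  have hN5R : ((a * u * v * p : ℕ) : ℝ) * (c : ℝ) ^ 4 ≤ (R : ℝ) ^ 16 := by exact_mod_cast hN5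
  have hN6R : (c : ℝ) ^ 4 ≤ (R : ℝ) ^ 12 * (Z : ℝ) ^ 4 := by exact_mod_cast hN6
  have hexc4 : (R : ℝ) ^ ((4 - η / 8) * 4) ≤ (c : ℝ) ^ 4 := by
    rw [Real.rpow_mul hx0.le, Real.rpow_ofNat]
    exact pow_le_pow_left₀ (Real.rpow_nonneg hx0.le _) hexc 4
  have hc4pos : (0 : ℝ) < (c : ℝ) ^ 4 := by positivity
  -- `a u v p ≤ R^(η/2)`
  have hauv : ((a * u * v * p : ℕ) : ℝ) ≤ (R : ℝ) ^ (η / 2) := by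
    have h1 : ((a * u * v * p : ℕ) : ℝ) ≤ (R : ℝ) ^ 16 / (c : ℝ) ^ 4 := by
      rw [le_div_iff₀ hc4pos]; exact hN5R
    have h2 : (R : ℝ) ^ 16 / (c : ℝ) ^ 4 ≤ (R : ℝ) ^ 16 / (R : ℝ) ^ ((4 - η / 8) * 4) :=
      div_le_div_of_nonneg_left (by positivity) (Real.rpow_pos_of_pos hx0 _) hexc4
    have h3 : (R : ℝ) ^ 16 / (R : ℝ) ^ ((4 - η / 8) * 4) = (R : ℝ) ^ (η / 2) := by
      have : (R : ℝ) ^ (16 : ℕ) = (R : ℝ) ^ ((4 - η / 8) * 4) * (R : ℝ) ^ (η / 2) := by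
        rw [← Real.rpow_add hx0]
        have he : (4 - η / 8) * 4 + η / 2 = ((16 : ℕ) : ℝ) := by push_cast; ring
        rw [he, Real.rpow_natCast]
      rw [this]
      have hne : (R : ℝ) ^ ((4 - η / 8) * 4) ≠ 0 := (Real.rpow_pos_of_pos hx0 _).ne'
      field_simp
    exact h1.trans (h2.trans h3.le)
  -- `R^(4 − η/2) ≤ Z⁴`
  have hZ4 : (R : ℝ) ^ (4 - η / 2) ≤ (Z : ℝ) ^ 4 := by
    have h1 : (R : ℝ) ^ (4 - η / 2) * (R : ℝ) ^ (12 : ℝ) = (R : ℝ) ^ ((4 - η / 8) * 4) := by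
      rw [← Real.rpow_add hx0]; ring_nf
    have hx12 : (0 : ℝ) < (R : ℝ) ^ (12 : ℝ) := Real.rpow_pos_of_pos hx0 _
    have h2 : (R : ℝ) ^ (4 - η / 2) * (R : ℝ) ^ (12 : ℝ) ≤ (Z : ℝ) ^ 4 * (R : ℝ) ^ (12 : ℝ) := by
      calc _ = (R : ℝ) ^ ((4 - η / 8) * 4) := h1
        _ ≤ (c : ℝ) ^ 4 := hexc4
        _ ≤ (R : ℝ) ^ 12 * (Z : ℝ) ^ 4 := hN6R
        _ = (Z : ℝ) ^ 4 * (R : ℝ) ^ (12 : ℝ) := by rw [← Real.rpow_natCast (R : ℝ) 12]; push_cast; ring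
    exact le_of_mul_le_mul_right h2 hx12
  -- `R^(η/2) ≤ Z^η`
  have hZη : (R : ℝ) ^ (η / 2) ≤ (Z : ℝ) ^ η := by
    have h1 : ((R : ℝ) ^ (4 - η / 2)) ^ (η / 4) ≤ ((Z : ℝ) ^ 4) ^ (η / 4) :=
      Real.rpow_le_rpow (Real.rpow_nonneg hx0.le _) hZ4 (by positivity)
    have h2 : ((Z : ℝ) ^ 4) ^ (η / 4) = (Z : ℝ) ^ η := by
      rw [← Real.rpow_natCast, ← Real.rpow_mul hZ0]; congr 1; push_cast; ring
    have h3 : ((R : ℝ) ^ (4 - η / 2)) ^ (η / 4) = (R : ℝ) ^ ((4 - η / 2) * (η / 4)) := by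
      rw [← Real.rpow_mul hx0.le]
    have h4 : (R : ℝ) ^ (η / 2) ≤ (R : ℝ) ^ ((4 - η / 2) * (η / 4)) := by
      apply Real.rpow_le_rpow_of_exponent_le hx1; nlinarith
    calc (R : ℝ) ^ (η / 2) ≤ (R : ℝ) ^ ((4 - η / 2) * (η / 4)) := h4
      _ = ((R : ℝ) ^ (4 - η / 2)) ^ (η / 4) := h3.symm
      _ ≤ ((Z : ℝ) ^ 4) ^ (η / 4) := h1
      _ = (Z : ℝ) ^ η := h2
  have hZB : Z ≤ B := hB a u v p k Z hp ha hu hv hZ heq hcopr (hauv.trans hZη)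
  -- `R² ≤ R^(4−η/2) ≤ Z⁴ ≤ B⁴`
  have hR2 : (R : ℝ) ^ (2 : ℕ) ≤ ((B : ℝ) ^ 2) ^ (2 : ℕ) := by
    have h1 : (R : ℝ) ^ ((2 : ℕ) : ℝ) ≤ (R : ℝ) ^ (4 - η / 2) :=
      Real.rpow_le_rpow_of_exponent_le hx1 (by push_cast; linarith)
    have h2 : (Z : ℝ) ^ 4 ≤ (B : ℝ) ^ 4 := by exact_mod_cast Nat.pow_le_pow_left hZB 4
    calc (R : ℝ) ^ (2 : ℕ) = (R : ℝ) ^ ((2 : ℕ) : ℝ) := (Real.rpow_natCast _ 2).symm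
      _ ≤ (R : ℝ) ^ (4 - η / 2) := h1
      _ ≤ (Z : ℝ) ^ 4 := hZ4
      _ ≤ (B : ℝ) ^ 4 := h2
      _ = ((B : ℝ) ^ 2) ^ (2 : ℕ) := by ring
  exact le_of_pow_le_pow_left₀ two_ne_zero (by positivity) hR2

/-- Exceptional triples with the deep prime in `c`: from `a·u·v·p·b⁴ ≤ R¹⁶`, `b⁴ ≤ R¹²·Y⁴`, `c ≤ 2b` and `c ≥ R^(4−η/8)`
one gets `a·u·v·p ≤ 16R^(η/2)` and `R^(4−η/2) ≤ 16Y⁴`; if moreover `R^(3η/8) ≥ 32` then `a·u·v·p ≤ Y^η`, the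
Thue–Mahler hypothesis bounds `Y`, and `R ≤ 4B²`. [folklore] -/
theorem cellOne_radius_C {η : ℝ} {B : ℕ} (hη : 0 < η) (hη1 : η ≤ 1)
    (hB : ∀ a u v p w Y : ℕ, p.Prime → 0 < a → 0 < u → 0 < v → 0 < Y →
        a + u * Y ^ 4 = p ^ w * v → Nat.Coprime (u * Y ^ 4) (p ^ w * v) →
        ((a * u * v * p : ℕ) : ℝ) ≤ (Y : ℝ) ^ η → Y ≤ B)
    {a u v p w Y b c R : ℕ} (hp : p.Prime) (ha : 0 < a) (hu : 0 < u) (hv : 0 < v) (hY : 0 < Y)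
    (heq : a + u * Y ^ 4 = p ^ w * v) (hcopr : Nat.Coprime (u * Y ^ 4) (p ^ w * v))
    (hc2b : c ≤ 2 * b) (hN5 : a * u * v * p * b ^ 4 ≤ R ^ 16) (hN6 : b ^ 4 ≤ R ^ 12 * Y ^ 4)
    (hR1 : 1 ≤ R) (hb : 0 < b) (hexc : (R : ℝ) ^ (4 - η / 8) ≤ (c : ℝ))
    (hbig : (32 : ℝ) ≤ (R : ℝ) ^ (3 * η / 8)) : (R : ℝ) ≤ 4 * (B : ℝ) ^ 2 := by
  have hx1 : (1 : ℝ) ≤ (R : ℝ) := by exact_mod_cast hR1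
  have hx0 : (0 : ℝ) < (R : ℝ) := by linarith
  have hY1 : (1 : ℝ) ≤ (Y : ℝ) := by exact_mod_cast hY
  have hY0 : (0 : ℝ) ≤ (Y : ℝ) := by positivity
  have hbpos : (0 : ℝ) < (b : ℝ) := by exact_mod_cast hb
  have hN5R : ((a * u * v * p : ℕ) : ℝ) * (b : ℝ) ^ 4 ≤ (R : ℝ) ^ 16 := by exact_mod_cast hN5
  have hN6R : (b : ℝ) ^ 4 ≤ (R : ℝ) ^ 12 * (Y : ℝ) ^ 4 := by exact_mod_cast hN6
  have hc2bR : (c : ℝ) ≤ 2 * (b : ℝ) := by exact_mod_cast hc2b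
  have hexc4 : (R : ℝ) ^ ((4 - η / 8) * 4) ≤ (c : ℝ) ^ 4 := by
    rw [Real.rpow_mul hx0.le, Real.rpow_ofNat]
    exact pow_le_pow_left₀ (Real.rpow_nonneg hx0.le _) hexc 4
  have hcb4 : (c : ℝ) ^ 4 ≤ 16 * (b : ℝ) ^ 4 := by
    have h0c : (0 : ℝ) ≤ (c : ℝ) := by positivity
    calc (c : ℝ) ^ 4 ≤ (2 * (b : ℝ)) ^ 4 := pow_le_pow_left₀ h0c hc2bR 4
      _ = 16 * (b : ℝ) ^ 4 := by ring
  have hb4pos : (0 : ℝ) < (b : ℝ) ^ 4 := by positivity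
  have hRb : (R : ℝ) ^ ((4 - η / 8) * 4) ≤ 16 * (b : ℝ) ^ 4 := hexc4.trans hcb4
  -- `a u v p ≤ 16 R^(η/2)`
  have hauv : ((a * u * v * p : ℕ) : ℝ) ≤ 16 * (R : ℝ) ^ (η / 2) := by
    have h1 : ((a * u * v * p : ℕ) : ℝ) ≤ (R : ℝ) ^ 16 / (b : ℝ) ^ 4 := by
      rw [le_div_iff₀ hb4pos]; exact hN5R
    have hR16pos : (0 : ℝ) < (R : ℝ) ^ ((4 - η / 8) * 4) / 16 := by
      have := Real.rpow_pos_of_pos hx0 ((4 - η / 8) * 4); positivity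
    have h2 : (R : ℝ) ^ 16 / (b : ℝ) ^ 4 ≤ (R : ℝ) ^ 16 / ((R : ℝ) ^ ((4 - η / 8) * 4) / 16) :=
      div_le_div_of_nonneg_left (by positivity) hR16pos (by linarith)
    have h3 : (R : ℝ) ^ 16 / ((R : ℝ) ^ ((4 - η / 8) * 4) / 16) = 16 * (R : ℝ) ^ (η / 2) := by
      have : (R : ℝ) ^ (16 : ℕ) = (R : ℝ) ^ ((4 - η / 8) * 4) * (R : ℝ) ^ (η / 2) := by
        rw [← Real.rpow_add hx0]
        have he : (4 - η / 8) * 4 + η / 2 = ((16 : ℕ) : ℝ) := by push_cast; ring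
        rw [he, Real.rpow_natCast]
      rw [this]
      have hne : (R : ℝ) ^ ((4 - η / 8) * 4) ≠ 0 := (Real.rpow_pos_of_pos hx0 _).ne'
      field_simp
    exact h1.trans (h2.trans h3.le)
  -- `R^(4 − η/2) ≤ 16 Y⁴`
  have hY4 : (R : ℝ) ^ (4 - η / 2) ≤ 16 * (Y : ℝ) ^ 4 := by
    have h1 : (R : ℝ) ^ (4 - η / 2) * (R : ℝ) ^ (12 : ℝ) = (R : ℝ) ^ ((4 - η / 8) * 4) := by
      rw [← Real.rpow_add hx0]; ring_nf
    have hx12 : (0 : ℝ) < (R : ℝ) ^ (12 : ℝ) := Real.rpow_pos_of_pos hx0 _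
    have h2 : (R : ℝ) ^ (4 - η / 2) * (R : ℝ) ^ (12 : ℝ) ≤ (16 * (Y : ℝ) ^ 4) * (R : ℝ) ^ (12 : ℝ) := by
      calc _ = (R : ℝ) ^ ((4 - η / 8) * 4) := h1
        _ ≤ 16 * (b : ℝ) ^ 4 := hRb
        _ ≤ 16 * ((R : ℝ) ^ 12 * (Y : ℝ) ^ 4) := by linarith
        _ = (16 * (Y : ℝ) ^ 4) * (R : ℝ) ^ (12 : ℝ) := by
            rw [← Real.rpow_natCast (R : ℝ) 12]; push_cast; ring
    exact le_of_mul_le_mul_right h2 hx12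
  -- step 1: `32 R^(η/2) ≤ R^((4 − η/2)(η/4))`
  have hexp : 3 * η / 8 ≤ (4 - η / 2) * (η / 4) - η / 2 := by nlinarith
  have hstep1 : 32 * (R : ℝ) ^ (η / 2) ≤ (R : ℝ) ^ ((4 - η / 2) * (η / 4)) := by
    have h1 : (32 : ℝ) ≤ (R : ℝ) ^ ((4 - η / 2) * (η / 4) - η / 2) :=
      hbig.trans (Real.rpow_le_rpow_of_exponent_le hx1 hexp)
    have h2 : (R : ℝ) ^ ((4 - η / 2) * (η / 4) - η / 2) * (R : ℝ) ^ (η / 2) =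
        (R : ℝ) ^ ((4 - η / 2) * (η / 4)) := by
      rw [← Real.rpow_add hx0]; ring_nf
    have h3 : (0 : ℝ) ≤ (R : ℝ) ^ (η / 2) := Real.rpow_nonneg hx0.le _
    calc 32 * (R : ℝ) ^ (η / 2) ≤ (R : ℝ) ^ ((4 - η / 2) * (η / 4) - η / 2) * (R : ℝ) ^ (η / 2) :=
          mul_le_mul_of_nonneg_right h1 h3
      _ = _ := h2
  -- step 2: `R^((4 − η/2)(η/4)) ≤ (16 Y⁴)^(η/4) ≤ 2 · Y^η`
  have hstep2 : (R : ℝ) ^ ((4 - η / 2) * (η / 4)) ≤ 2 * (Y : ℝ) ^ η := by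
    have h1 : ((R : ℝ) ^ (4 - η / 2)) ^ (η / 4) ≤ (16 * (Y : ℝ) ^ 4) ^ (η / 4) :=
      Real.rpow_le_rpow (Real.rpow_nonneg hx0.le _) hY4 (by positivity)
    have h2 : ((R : ℝ) ^ (4 - η / 2)) ^ (η / 4) = (R : ℝ) ^ ((4 - η / 2) * (η / 4)) := by
      rw [← Real.rpow_mul hx0.le]
    have h3 : (16 * (Y : ℝ) ^ 4) ^ (η / 4) = (16 : ℝ) ^ (η / 4) * (Y : ℝ) ^ η := by
      rw [Real.mul_rpow (by norm_num) (by positivity)]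
      congr 1
      rw [← Real.rpow_natCast, ← Real.rpow_mul hY0]; congr 1; push_cast; ring
    have h4 : (16 : ℝ) ^ (η / 4) ≤ 2 := by
      have h16 : (16 : ℝ) = 2 ^ (4 : ℝ) := by norm_num
      calc (16 : ℝ) ^ (η / 4) ≤ (16 : ℝ) ^ ((1 : ℝ) / 4) :=
            Real.rpow_le_rpow_of_exponent_le (by norm_num) (by linarith)
        _ = 2 := by rw [h16, ← Real.rpow_mul (by norm_num)]; norm_num
    have h5 : (0 : ℝ) ≤ (Y : ℝ) ^ η := Real.rpow_nonneg hY0 _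
    calc (R : ℝ) ^ ((4 - η / 2) * (η / 4)) = ((R : ℝ) ^ (4 - η / 2)) ^ (η / 4) := h2.symm
      _ ≤ (16 * (Y : ℝ) ^ 4) ^ (η / 4) := h1
      _ = (16 : ℝ) ^ (η / 4) * (Y : ℝ) ^ η := h3
      _ ≤ 2 * (Y : ℝ) ^ η := mul_le_mul_of_nonneg_right h4 h5
  have hYη : ((a * u * v * p : ℕ) : ℝ) ≤ (Y : ℝ) ^ η := by linarith [hauv, hstep1, hstep2]
  have hYB : Y ≤ B := hB a u v p w Y hp ha hu hv hY heq hcopr hYη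
  have hR2 : (R : ℝ) ^ (2 : ℕ) ≤ (4 * (B : ℝ) ^ 2) ^ (2 : ℕ) := by
    have h1 : (R : ℝ) ^ ((2 : ℕ) : ℝ) ≤ (R : ℝ) ^ (4 - η / 2) :=
      Real.rpow_le_rpow_of_exponent_le hx1 (by push_cast; linarith)
    have h2 : (Y : ℝ) ^ 4 ≤ (B : ℝ) ^ 4 := by exact_mod_cast Nat.pow_le_pow_left hYB 4
    calc (R : ℝ) ^ (2 : ℕ) = (R : ℝ) ^ ((2 : ℕ) : ℝ) := (Real.rpow_natCast _ 2).symm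
      _ ≤ (R : ℝ) ^ (4 - η / 2) := h1
      _ ≤ 16 * (Y : ℝ) ^ 4 := hY4
      _ ≤ 16 * (B : ℝ) ^ 4 := by linarith
      _ = (4 * (B : ℝ) ^ 2) ^ (2 : ℕ) := by ring
  exact le_of_pow_le_pow_left₀ two_ne_zero (by positivity) hR2

open UniqueFactorizationMonoid (radical) in
open Literature.NumberTheory.DiophantineGeometry (IsABCTriple rad rad_def) in
/-- **Stub `stub_cellOneOfUniformQuarticThueMahler` (the weakest open face of cell 1) of line `Sketch`, crux
`DepthCountedABC` (stmt-ABC-14938):** if for some `η > 0` the positive coprime solutions of `a + p^k·u = v·Z⁴` with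
`a·u·v·p ≤ Z^η` have bounded `Z` and those of `a + u·Y⁴ = p^w·v` with `a·u·v·p ≤ Y^η` have bounded `Y` (`p` prime;
uniform binomial quartic Thue–Mahler), then abc holds on the cell `#{p : v_p(abc) ≥ 5} ≤ 1` with SOME exponent
`4 − δ < 4` (`δ = min(η,1)/8` works). [folklore reduction; hypothesis open] -/
theorem stub_cellOneOfUniformQuarticThueMahler : ∀ η : ℝ, 0 < η →
    (∃ B : ℕ, ∀ a u v p k Z : ℕ, p.Prime → 0 < a → 0 < u → 0 < v → 0 < Z →
        a + p ^ k * u = v * Z ^ 4 → Nat.Coprime (p ^ k * u) (v * Z ^ 4) →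
        ((a * u * v * p : ℕ) : ℝ) ≤ (Z : ℝ) ^ η → Z ≤ B) →
    (∃ B : ℕ, ∀ a u v p w Y : ℕ, p.Prime → 0 < a → 0 < u → 0 < v → 0 < Y →
        a + u * Y ^ 4 = p ^ w * v → Nat.Coprime (u * Y ^ 4) (p ^ w * v) →
        ((a * u * v * p : ℕ) : ℝ) ≤ (Y : ℝ) ^ η → Y ≤ B) →
    ∃ δ : ℝ, 0 < δ ∧ ∃ C : ℝ, 0 < C ∧ ∀ a b c : ℕ,
      Literature.NumberTheory.DiophantineGeometry.IsABCTriple a b c →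
      ((a * b * c).primeFactors.filter (fun p => 5 ≤ (a * b * c).factorization p)).card ≤ 1 →
      (c : ℝ) < C * ((Literature.NumberTheory.DiophantineGeometry.rad a b c : ℕ) : ℝ) ^ (4 - δ) := by
  intro η hη hB1 hB2
  obtain ⟨B₁, hB1⟩ := hB1
  obtain ⟨B₂, hB2⟩ := hB2
  -- pass to `η' = min η 1`
  set η' : ℝ := min η 1 with hη'
  have hη'pos : 0 < η' := lt_min hη one_pos
  have hη'le : η' ≤ η := min_le_left _ _
  have hη'le1 : η' ≤ 1 := min_le_right _ _
  have hB1' : ∀ a u v p k Z : ℕ, p.Prime → 0 < a → 0 < u → 0 < v → 0 < Z →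
      a + p ^ k * u = v * Z ^ 4 → Nat.Coprime (p ^ k * u) (v * Z ^ 4) →
      ((a * u * v * p : ℕ) : ℝ) ≤ (Z : ℝ) ^ η' → Z ≤ B₁ := by
    intro a u v p k Z hp ha hu hv hZ heq hcop hle
    have hZ1 : (1 : ℝ) ≤ (Z : ℝ) := by exact_mod_cast hZ
    exact hB1 a u v p k Z hp ha hu hv hZ heq hcop (hle.trans (Real.rpow_le_rpow_of_exponent_le hZ1 hη'le))
  have hB2' : ∀ a u v p w Y : ℕ, p.Prime → 0 < a → 0 < u → 0 < v → 0 < Y →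
      a + u * Y ^ 4 = p ^ w * v → Nat.Coprime (u * Y ^ 4) (p ^ w * v) →
      ((a * u * v * p : ℕ) : ℝ) ≤ (Y : ℝ) ^ η' → Y ≤ B₂ := by
    intro a u v p w Y hp ha hu hv hY heq hcop hle
    have hY1 : (1 : ℝ) ≤ (Y : ℝ) := by exact_mod_cast hY
    exact hB2 a u v p w Y hp ha hu hv hY heq hcop (hle.trans (Real.rpow_le_rpow_of_exponent_le hY1 hη'le))
  set δ : ℝ := η' / 8 with hδ
  have hδpos : 0 < δ := by positivity
  set R₀ : ℝ := (B₁ : ℝ) ^ 2 + 4 * (B₂ : ℝ) ^ 2 + (32 : ℝ) ^ (8 / (3 * η')) + 1 with hR₀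
  have hT : (0 : ℝ) < (32 : ℝ) ^ (8 / (3 * η')) := Real.rpow_pos_of_pos (by norm_num) _
  have hR₀0 : (0 : ℝ) ≤ R₀ := by rw [hR₀]; positivity
  have hR₀4 : (0 : ℝ) ≤ R₀ ^ 4 := by positivity
  set C : ℝ := 2 * R₀ ^ 4 + 2 with hC
  have hCpos : (0 : ℝ) < C := by positivity
  have hC2 : (2 : ℝ) ≤ C := by rw [hC]; linarith
  refine ⟨δ, hδpos, C, hCpos, ?_⟩
  intro a b c habc hK
  -- WLOG `a ≤ b`
  wlog hab : a ≤ b generalizing a b with H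
  · have hsw : IsABCTriple b a c :=
      ⟨habc.2.1, habc.1, by rw [add_comm]; exact habc.2.2.1, habc.2.2.2.symm⟩
    have hprod : b * a * c = a * b * c := by ring
    have hK' : ((b * a * c).primeFactors.filter (fun p => 5 ≤ (b * a * c).factorization p)).card ≤ 1 := by
      rw [hprod]; exact hK
    have := H b a hsw hK' (le_of_not_ge hab)
    rwa [rad_def, hprod, ← rad_def] at this
  set R := rad a b c with hR
  have hR1nat : 1 ≤ R := by rw [hR, rad_def]; exact Nat.radical_pos _
  have hx1 : (1 : ℝ) ≤ (R : ℝ) := by exact_mod_cast hR1nat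
  have hx0 : (0 : ℝ) < (R : ℝ) := by linarith
  have hδ4 : (0 : ℝ) ≤ 4 - δ := by rw [hδ]; linarith
  have hpow1 : (1 : ℝ) ≤ (R : ℝ) ^ (4 - δ) := Real.one_le_rpow hx1 hδ4
  have hpow0 : (0 : ℝ) ≤ (R : ℝ) ^ (4 - δ) := by linarith
  have hpow2 : (R : ℝ) ^ (2 : ℕ) ≤ (R : ℝ) ^ (4 - δ) := by
    calc (R : ℝ) ^ (2 : ℕ) = (R : ℝ) ^ ((2 : ℕ) : ℝ) := (Real.rpow_natCast _ 2).symm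
      _ ≤ (R : ℝ) ^ (4 - δ) := Real.rpow_le_rpow_of_exponent_le hx1 (by rw [hδ]; push_cast; linarith)
  have hcal : c ≤ 2 * R ^ 4 := calibration_one a b c habc hK
  have hcalR : (c : ℝ) ≤ 2 * (R : ℝ) ^ 4 := by exact_mod_cast hcal
  have hc : 0 < c := by have := habc.2.2.1; have := habc.1; omega
  -- an exceptional triple with `R ≤ R₀` satisfies the bound
  have finish : (R : ℝ) ≤ R₀ → (c : ℝ) < C * (R : ℝ) ^ (4 - δ) := by
    intro hRR₀
    have hR4 : (R : ℝ) ^ 4 ≤ R₀ ^ 4 := pow_le_pow_left₀ hx0.le hRR₀ 4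
    calc (c : ℝ) ≤ 2 * (R : ℝ) ^ 4 := hcalR
      _ ≤ 2 * R₀ ^ 4 := by linarith
      _ < C := by rw [hC]; linarith
      _ = C * 1 := (mul_one _).symm
      _ ≤ C * (R : ℝ) ^ (4 - δ) := mul_le_mul_of_nonneg_left hpow1 hCpos.le
  -- a non-exceptional triple satisfies the bound
  have easy : (c : ℝ) < (R : ℝ) ^ (4 - δ) → (c : ℝ) < C * (R : ℝ) ^ (4 - δ) := by
    intro hlt
    calc (c : ℝ) < (R : ℝ) ^ (4 - δ) := hlt
      _ = 1 * (R : ℝ) ^ (4 - δ) := (one_mul _).symm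
      _ ≤ C * (R : ℝ) ^ (4 - δ) := mul_le_mul_of_nonneg_right (by linarith) hpow0
  have hδη : 4 - δ = 4 - η' / 8 := by rw [hδ]
  rcases stub_cellOneCases a b c habc hab hK with hlt | hBcfg | hCcfg
  · -- `c < 2R²`
    have h1 : (c : ℝ) < 2 * (R : ℝ) ^ 2 := by exact_mod_cast hlt
    calc (c : ℝ) < 2 * (R : ℝ) ^ 2 := h1
      _ ≤ 2 * (R : ℝ) ^ (4 - δ) := by linarith
      _ ≤ C * (R : ℝ) ^ (4 - δ) := mul_le_mul_of_nonneg_right hC2 hpow0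
  · obtain ⟨p, k, u, v, Z, hp, hu, hv, hZ, heq, hcopr, -, hN5, hN6⟩ := hBcfg
    by_cases hexc : (R : ℝ) ^ (4 - δ) ≤ (c : ℝ)
    · rw [hδη] at hexc
      have hRB := cellOne_radius_B hη'pos hη'le1 hB1' hp habc.1 hu hv hZ heq hcopr hN5 hN6 hR1nat hc hexc
      apply finish
      rw [hR₀]
      have : (0 : ℝ) ≤ 4 * (B₂ : ℝ) ^ 2 := by positivity
      linarith
    · exact easy (not_le.mp hexc)
  · obtain ⟨p, w, u, v, Y, hp, hu, hv, hY, heq, hcopr, -, hc2b, hN5, hN6⟩ := hCcfg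
    by_cases hexc : (R : ℝ) ^ (4 - δ) ≤ (c : ℝ)
    · rw [hδη] at hexc
      apply finish
      by_cases hbig : (32 : ℝ) ≤ (R : ℝ) ^ (3 * η' / 8)
      · have hRB := cellOne_radius_C hη'pos hη'le1 hB2' hp habc.1 hu hv hY heq hcopr hc2b hN5 hN6 hR1nat
          habc.2.1 hexc hbig
        rw [hR₀]
        have : (0 : ℝ) ≤ (B₁ : ℝ) ^ 2 := by positivity
        linarith
      · push Not at hbig
        have h1 : ((R : ℝ) ^ (3 * η' / 8)) ^ (8 / (3 * η')) < (32 : ℝ) ^ (8 / (3 * η')) :=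
          Real.rpow_lt_rpow (Real.rpow_nonneg hx0.le _) hbig (by positivity)
        have h2 : ((R : ℝ) ^ (3 * η' / 8)) ^ (8 / (3 * η')) = (R : ℝ) := by
          rw [← Real.rpow_mul hx0.le]
          have : 3 * η' / 8 * (8 / (3 * η')) = 1 := by field_simp
          rw [this, Real.rpow_one]
        rw [h2] at h1
        rw [hR₀]
        have : (0 : ℝ) ≤ (B₁ : ℝ) ^ 2 + 4 * (B₂ : ℝ) ^ 2 := by positivity
        linarith
    · exact easy (not_le.mp hexc)

end Summit.ABC.ABC.Theorems.DepthCountedABC
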